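import Mathlib
import HarnessLib

/-!
# The simplest quartic Thue equations and the equation `X² + 1 = dY⁴`

Two NAMED FACTS (statements only, `def … : Prop`; no proof in the tree) from
Chen Jian Hua – P. Voutier, *Complete solution of the Diophantine equation `X² + 1 = dY⁴` and a
related family of quartic Thue equations*, J. Number Theory **62** (1997) 71–99
[ChenVoutier1997] (read on the page: arXiv:1401.5450, p. 1), the second also proved independently by
G. Lettl – A. Pethő, Abh. Math. Sem. Univ. Hamburg **65** (1995) 365–383 [LettlPetho1995]:

* `simplestQuarticForm t x y = x⁴ − t x³y − 6 x²y² + t xy³ + y⁴` — the "simplest quartic" binary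
  forms `P_t` (cyclic quartic fields; `P_3 = (X² + XY − Y²)(X² − 4XY − Y²)` is reducible).
* `SimplestQuarticThueSolutions` — **Theorem 3 of [ChenVoutier1997] (= [LettlPetho1995])**: for
  `t ≥ 1`, `t ≠ 3`, all integer solutions of `P_t(X,Y) = ±1` are listed: for `t = 1` the eight points
  `(−2,1), (−1,−2), (−1,0), (0,±1), (1,0), (1,2), (2,−1)`; for `t = 4` the eight points
  `(−3,2), (−2,−3), (−1,0), (0,±1), (1,0), (2,3), (3,−2)`; for `t = 2` or `t ≥ 5` only the trivial
  `(±1,0), (0,±1)`.  (The first infinite family of Thue equations solved uniformly in the parameter by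
  the hypergeometric Thue–Siegel method; Lettl–Pethő use linear forms in two logarithms.)
  **Erratum (sign typo in the printed statement, corrected here).** The printed `t = 4` list
  (arXiv:1401.5450 p. 1, and the first revision of this file) has `(−2, 3)` in place of `(−2, −3)`;
  but `P_4(−2, 3) = −239` whereas `P_4(−2, −3) = 1` (`simplestQuarticForm_four_neg_two_three`,
  `simplestQuarticForm_four_solutions` below).  The solution set of `P_4 = ±1` is
  `{±(1,0), ±(0,1), ±(2,3), ±(3,−2)}`, one orbit `(2,3) ↦ (3,−2) ↦ (−2,−3) ↦ (−3,2)` of the order-4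
  automorphism `(x, y) ↦ (y, −x)` of `P_t` plus the trivial orbit — exactly as the (correctly printed)
  `t = 1` list `±(1,2), ±(2,−1)`.  With the printed list the `def` below was refutable by `decide`
  (crux-triage r2-k1 of stmt-ABC-14937, 2026-08-16); its one consumer
  (`Summits/ABC/ABC/Theorems/IneffectiveSubspaceUniformSadicTowerFourCellSettledHalf.lean`) uses the
  list only through `x² + y² ∈ {1, 13}`, which the correction does not change.
* `NegPellQuarticAtMostOne` — **Theorem 4 of [ChenVoutier1997]**: for `d ≥ 3` the equation
  `X² + 1 = dY⁴` has at most one solution in positive integers, and if `(x, y)` is one then `v = y²`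
  for the fundamental (= least positive) solution `(u, v)` of `X² + 1 = dY²`.  (For `d = 2` the
  solutions are `(1,1)` and `(239,13)` — Ljunggren 1942; `239² + 1 = 2·13⁴`.)

Dictionary used by consumers (crux `UniformSadicTowerFour` of `Summits/ABC`, line `SketchIdeator4`):
in `ℤ[i]`, `Im((a + bi)⁴·(−x₀ + i)) = P_{4x₀}(a, b)`, so Theorem 3 at `t = 4x₀` controls the solutions of
`X² + 1 = (1 + x₀²)·Y⁴` (this is how [ChenVoutier1997, §4] derive Theorem 4).

What is deliberately NOT here: no proofs (both theorems rest on explicit Padé approximants /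
Baker's method plus extensive computation); the `±4` right-hand side treated in [LettlPetho1995] is
omitted; "fundamental solution" is spelled out as "least positive solution" since Mathlib's `Pell`
API covers only the positive Pell equation.
-/

namespace Literature.NumberTheory.DiophantineGeometry

/-- The **simplest quartic form** `P_t(X, Y) = X⁴ − tX³Y − 6X²Y² + tXY³ + Y⁴`
[cite: ChenVoutier1997, Thm 3 (eq. 1.2)]. -/
def simplestQuarticForm (t x y : ℤ) : ℤ :=
  x ^ 4 - t * x ^ 3 * y - 6 * x ^ 2 * y ^ 2 + t * x * y ^ 3 + y ^ 4

/-- **Chen–Voutier 1997, Theorem 3 (= Lettl–Pethő 1995): complete solution of the simplest quartic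
Thue equations `P_t(X,Y) = ±1`, `t ≥ 1`, `t ≠ 3`.**  "For `t = 1`, if `(x,y)` is an integer solution
then `(x,y) ∈ {(−2,1), (−1,−2), (−1,0), (0,±1), (1,0), (1,2), (2,−1)}`.  For `t = 4`, if `(x,y)` is an
integer solution then `(x,y) ∈ {(−3,2), (−2,−3), (−1,0), (0,±1), (1,0), (2,3), (3,−2)}`.  For `t = 2` or
`t ≥ 5`, if `(x,y)` is an integer solution then `(x,y) = (±1, 0)` or `(0, ±1)`."  (The printed `t = 4`
list reads `(−2, 3)`: a sign typo for `(−2, −3)` — `P_4(−2, 3) = −239`, `P_4(−2, −3) = 1`; see the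
module docstring's Erratum and `simplestQuarticForm_four_solutions`.)
[cite: ChenVoutier1997, Thm 3] -/
def SimplestQuarticThueSolutions : Prop :=
  ∀ t : ℤ, 1 ≤ t → t ≠ 3 → ∀ x y : ℤ,
    (simplestQuarticForm t x y = 1 ∨ simplestQuarticForm t x y = -1) →
      (t = 1 ∧ (x, y) ∈ ({(-2, 1), (-1, -2), (-1, 0), (0, 1), (0, -1), (1, 0), (1, 2), (2, -1)} :
        Set (ℤ × ℤ))) ∨
      (t = 4 ∧ (x, y) ∈ ({(-3, 2), (-2, -3), (-1, 0), (0, 1), (0, -1), (1, 0), (2, 3), (3, -2)} :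
        Set (ℤ × ℤ))) ∨
      ((t = 2 ∨ 5 ≤ t) ∧ (x, y) ∈ ({(1, 0), (-1, 0), (0, 1), (0, -1)} : Set (ℤ × ℤ)))

/-- Converse sanity check of the `t = 1` clause: each of the eight listed points IS a solution of
`P_1 = ±1`. [folklore] -/
theorem simplestQuarticForm_one_solutions :
    ∀ p ∈ ([(-2, 1), (-1, -2), (-1, 0), (0, 1), (0, -1), (1, 0), (1, 2), (2, -1)] : List (ℤ × ℤ)),
      simplestQuarticForm 1 p.1 p.2 = 1 ∨ simplestQuarticForm 1 p.1 p.2 = -1 := by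
  decide

/-- Converse sanity check of the (corrected) `t = 4` clause: each of the eight listed points IS a
solution of `P_4 = ±1`. [folklore] -/
theorem simplestQuarticForm_four_solutions :
    ∀ p ∈ ([(-3, 2), (-2, -3), (-1, 0), (0, 1), (0, -1), (1, 0), (2, 3), (3, -2)] : List (ℤ × ℤ)),
      simplestQuarticForm 4 p.1 p.2 = 1 ∨ simplestQuarticForm 4 p.1 p.2 = -1 := by
  decide

/-- The point `(−2, 3)` of the PRINTED `t = 4` list is not a solution: `P_4(−2, 3) = −239`
(Ljunggren's `239` again: `−239 = Re((3 + 2i)⁴(1 + i))`). [folklore] -/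
theorem simplestQuarticForm_four_neg_two_three : simplestQuarticForm 4 (-2) 3 = -239 := by
  norm_num [simplestQuarticForm]

/-- **Chen–Voutier 1997, Theorem 4: `X² + 1 = dY⁴` has at most one positive solution for `d ≥ 3`.**
"Let `(u,v)` be the fundamental solution of the Pell equation `X² + 1 = dY²`.  If `d ≥ 3`, then the
equation `X² + 1 = dY⁴` has at most one solution in positive integers.  If this solution `(x,y)`
exists, we have `v = y²`."  The second clause is stated with "fundamental solution" unfolded as the
least positive solution: `y² ≤ v` for every positive solution `(u, v)` of `X² + 1 = dY²` (and
`(x, y²)` is itself such a solution). [cite: ChenVoutier1997, Thm 4] -/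
def NegPellQuarticAtMostOne : Prop :=
  ∀ d : ℕ, 3 ≤ d →
    (∀ x₁ y₁ x₂ y₂ : ℕ, 0 < x₁ → 0 < y₁ → 0 < x₂ → 0 < y₂ →
      x₁ ^ 2 + 1 = d * y₁ ^ 4 → x₂ ^ 2 + 1 = d * y₂ ^ 4 → x₁ = x₂ ∧ y₁ = y₂) ∧
    (∀ x y : ℕ, 0 < x → 0 < y → x ^ 2 + 1 = d * y ^ 4 →
      ∀ u v : ℕ, 0 < v → u ^ 2 + 1 = d * v ^ 2 → y ^ 2 ≤ v)

/-- Sanity check of the listed `t = 4` solution `(3, −2)`: `P_4(3, −2) = 1`; it is Ljunggren's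
`239² + 1 = 2·13⁴` in disguise (`(3 + 2i)⁴(1 + i) = −239 + i`, `3² + 2² = 13`). [folklore] -/
theorem simplestQuarticForm_four_three_neg_two : simplestQuarticForm 4 3 (-2) = 1 := by
  norm_num [simplestQuarticForm]

/-- The `ℤ[i]` dictionary behind [ChenVoutier1997, §4]: `Im((a + bi)⁴·(−x₀ + i)) = P_{4x₀}(a, b)`.
[folklore] -/
theorem im_pow_four_mul_eq_simplestQuarticForm (x₀ a b : ℤ) :
    ((⟨a, b⟩ : GaussianInt) ^ 4 * (⟨-x₀, 1⟩ : GaussianInt)).im = simplestQuarticForm (4 * x₀) a b := by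
  simp only [pow_succ, pow_zero, one_mul, Zsqrtd.im_mul, Zsqrtd.re_mul, simplestQuarticForm]
  ring

end Literature.NumberTheory.DiophantineGeometry
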